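import Literature.AlgebraicGeometry.HodgeTheory.LefschetzOneOneProofs
import Literature.AlgebraicGeometry.Motives.GAGA
import Literature.AlgebraicGeometry.Motives.VarietiesProperProofs
import Literature.AlgebraicGeometry.Motives.VarietiesProjectiveSpaceProofs
import Literature.AlgebraicGeometry.Motives.AlgPointsProperProofs
import Literature.NumberTheory.Transcendental.AnalytificationProjProofs
import Literature.NumberTheory.Transcendental.AnalytificationFunctorialityProofs
import Literature.NumberTheory.Transcendental.ProjectiveSpaceProofs
import Literature.NumberTheory.Transcendental.ProjectiveSpaceT2Proofs
import HarnessLib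

/-!
# Chow's theorem for analytifications: reduction to Chow's theorem in `ℙᴺ(ℂ)` and GAGA §5

Family `hodge`, layer `Literature/AlgebraicGeometry/HodgeTheory`. Second proof layer under the named
fact `chow_analyticSet_analytification` of `LefschetzOneOneProofs.lean` (Serre, GAGA §19 Prop. 13
transported to an abstract analytification `φ : M → X(ℂ)` of a smooth projective `X`: every closed
analytic subset `S ⊆ M` is `φ⁻¹(Z(ℂ))` for a Zariski-closed `Z ⊆ X`).

The printed proof of Prop. 13 («Tout sous-ensemble analytique fermé de l'espace projectif est
algébrique», p. 29) runs through the whole of GAGA (Cartan's coherence of the ideal sheaf of `Y`,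
Théorème 3, Prop. 10 b)); the tree vendors its conclusion for `ℙᴺ(ℂ)` as the named fact
`Literature.AlgebraicGeometry.Motives.isProjAlgebraicSet_of_isAnalyticSet` (**hodge.S17**, `Motives/GAGA.lean`,
itself reduced there to the cone form `exists_finset_isHomogeneous_of_isCone`). What separates that
statement from `chow_analyticSet_analytification` is GAGA §5 (p. 9): «Si `Y` est un sous-ensemble
Z-localement fermé dans `X`, alors `Y^h` est un sous-ensemble analytique de `X^h`; de plus, la
structure analytique de `Y^h` coïncide avec la structure analytique induite sur `Y` par `X^h`»,
applied to the closed immersion `ι : X ↪ ℙᴺ`. This file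

1. vendors the two clauses of that sentence, for a closed immersion `g : X ⟶ Y` of `k`-schemes
   (`k ⊆ ℂ`) and analytifications `φ : M → X(ℂ)`, `ψ : M' → Y(ℂ)` in the sense of
   `Literature.NumberTheory.Transcendental.IsAnalytification`, as two named facts:
   * `isAnalyticSet_preimage_range_map_of_isClosedImmersion` — «`Y^h` est un sous-ensemble
     analytique de `X^h`»: `ψ⁻¹(g(ℂ)(X(ℂ)))` is an analytic subset of `M'` (locally on an affine open
     `V = Spec A` of `Y` it is the common zero set of generators of `ker (A → Γ(g⁻¹V))`, which are
     holomorphic on `ψ⁻¹(V(ℂ))` by definition of an analytification);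
   * `exists_mdifferentiableOn_extension_of_isClosedImmersion` — «la structure analytique de `Y^h`
     coïncide avec la structure analytique induite»: for `X`, `Y` smooth with holomorphic atlases on
     `M`, `M'` and `h : M → M'` the induced map (`ψ ∘ h = g(ℂ) ∘ φ`), every function holomorphic on
     an open `U ⊆ M` is, near each point of `U`, the pull-back along `h` of a function holomorphic on
     an open subset of `M'` (in Serre's language the structure sheaf of the analytic subspace `Y^h` is
     the sheaf of restrictions `ℋ_X/𝒜(Y^h)`, n°3; for smooth `Y ⊆ X` this is the local holomorphic
     retraction onto the complex submanifold `Y^h`);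
2. PROVES their corollary `isAnalyticSet_image_of_isClosedImmersion`: if moreover `h` is a closed
   embedding, `h` maps analytic subsets of `M` to analytic subsets of `M'` (local equations of `S`
   extend by 1(b), the equations of `h(M)` come from 1(a), and `h` identifies neighbourhoods);
3. PROVES the assembly `chow_analyticSet_analytification_of`: Chow's theorem in all `ℙᴺ(ℂ)`
   (`isProjAlgebraicSet_of_isAnalyticSet`) and the two facts imply `chow_analyticSet_analytification`.
   For `X` smooth projective over `ℂ` with `ι : X ↪ ℙᴺ` and an analytification `φ : M → X(ℂ)`
   (holomorphic atlas): `M` is compact (`IsSmoothProjective.isProper_holds`,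
   `compactSpace_algPoints_of_isProper_holds`), `ℙᴺ(ℂ)` with its standard atlas is a Hausdorff
   complex manifold and `projPoint N : ℙᴺ(ℂ) → ℙᴺ_ℂ(ℂ)` is its analytification
   (`isManifold_projectivization_holds`, `t2Space_projectivization_holds`,
   `isAnalytification_projPoint`, all proved in the tree), so `h = projPoint⁻¹ ∘ ι(ℂ) ∘ φ` is a
   continuous injection from a compact space, hence a closed embedding; by 2, `h(S)` is a closed
   analytic subset of `ℙᴺ(ℂ)`, by Chow the zero locus of homogeneous `F₁, …, Fᵣ`; with
   `Z := ι⁻¹(⋂ⱼ V₊(Fⱼ))` (Zariski-closed) one gets `S = φ⁻¹(Z(ℂ))` from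
   `preimage_projPoint_setOf_pt_mem_basicOpen` (`projPoint⁻¹(D₊(F)(ℂ)) = ℙᴺ(ℂ) ∖ V(F)`) and
   `AlgPoints.pt_map`.

## Design and faithfulness

* The two named facts are closed `Prop`s quantifying over universe-`0` carriers (`E M E' M' : Type`),
  as `chow_analyticSet_analytification` itself (the complex points `X(ℂ)` live in `Type`).
* 1(a) is stated for an arbitrary closed immersion into a `k`-scheme `Y` locally of finite type with
  an analytification `ψ` (no smoothness or atlas compatibility is needed for its truth: the local
  equations are pulled-back regular functions, holomorphic by `hψ` itself; finite type makes the
  ideal finitely generated). 1(b) carries the hypotheses of `IsAnalytification.unique` /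
  `mdifferentiable_comp_map` on both sides (smooth, locally of finite type, holomorphic atlases),
  under which `M ≅ X^an`, `M' ≅ Y^an` canonically; the conclusion is local (`W ∋ h x`) and asks the
  identity `F (h y) = f y` only on `U ∩ h⁻¹(W)`, where both sides are meaningful.
* The two §5 facts are general statements about analytifications; they are kept in this layer,
  next to the fact they decompose (`chow_analyticSet_analytification`), rather than in
  `NumberTheory/Transcendental/Analytification.lean` whose interface is frozen upstream of many files.
* Nothing here weakens `chow_analyticSet_analytification`; the assembly proves it outright from the
  three inputs. Remaining trust base after this file: `isProjAlgebraicSet_of_isAnalyticSet` (Chow in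
  `ℙᴺ`, deep) and the two §5 facts (elementary-to-moderate; dischargeable from the tree's
  analytification machinery, cf. `AnalytificationFunctorialityProofs`).

## What is NOT here

* The discharge of 1(a) (needs: complex points of `Y` over `g(X)` lift to `X` — `Spec ℂ → Spec A`
  killing `I` factors through `Spec (A/I) = g⁻¹(V)`) and of 1(b) (needs adapted holomorphic charts of
  `M'` along `h(M)`: Jacobian criterion for the smooth closed subscheme plus the holomorphic implicit
  function theorem, as in the proof of `mdifferentiable_comp_map_holds`).
* Chow's theorem in `ℙᴺ(ℂ)` itself (hodge.S17).

## References

* [SerreGAGA1956] J.-P. Serre, Géométrie algébrique et géométrie analytique, Ann. Inst. Fourier 6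
  (1956): §2 n°5 p. 9 (propriétés de `X^h`: sous-variétés, structure induite, fonctorialité), n°3
  (sous-espaces analytiques, faisceau `𝒜(Y)`), §19 Prop. 13 p. 29 (théorème de Chow).
* [Chow1949] W.-L. Chow, On compact complex analytic varieties, Amer. J. Math. 71 (1949), Thm. V.
-/

noncomputable section

open scoped Manifold ContDiff LinearAlgebra.Projectivization
open CategoryTheory AlgebraicGeometry
open Literature.AlgebraicGeometry.Motives (AlgPoints ComplexPoints SchemeOver)
open Literature.NumberTheory.Transcendental (IsAnalytification)
open Literature.Geometry.Kaehler (IsAnalyticSet IsAnalyticSetAt)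

namespace Literature.AlgebraicGeometry.HodgeTheory

section HodgeTheory

/-! ### GAGA §5: analytification of a closed subvariety (two named facts) -/

/-- **Analytification of a closed subvariety is an analytic subset** (Serre, GAGA §2 n°5, p. 9:
«Si `Y` est un sous-ensemble Z-localement fermé dans `X`, alors `Y^h` est un sous-ensemble
analytique de `X^h`», here for `Y` Z-closed). Rendering: let `g : X ⟶ Y` be a closed immersion of
`k`-schemes (`k ⊆ ℂ`), `Y` locally of finite type, and `ψ : M' → Y(ℂ)` an analytification of `Y`
(`IsAnalytification`: a homeomorphism onto the complex points with their strong topology along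
which regular functions pull back to holomorphic ones). Then the preimage under `ψ` of the image
`g(ℂ)(X(ℂ)) ⊆ Y(ℂ)` of the complex points of `X` is an analytic subset of `M'`
(`Literature.Geometry.Kaehler.IsAnalyticSet`: near every point of `M'` the common zero set of
finitely many holomorphic functions) — on an affine open `V = Spec A` of `Y`, a complex point lies
over `X` iff the generators of `ker (A → Γ(X, g⁻¹V))` vanish at it, and these are holomorphic on
`ψ⁻¹(V(ℂ))`. [cite: SerreGAGA1956, §2 n°5 p. 9 (Y^h sous-ensemble analytique de X^h) with n°5 Lemme 1 b)] -/
def isAnalyticSet_preimage_range_map_of_isClosedImmersion : Prop :=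
  ∀ ⦃k : Type⦄ [Field k] [Algebra k ℂ] ⦃X Y : SchemeOver k⦄ (g : X ⟶ Y) [IsClosedImmersion g.left]
    [LocallyOfFiniteType Y.hom]
    ⦃E' : Type⦄ [NormedAddCommGroup E'] [NormedSpace ℂ E'] [FiniteDimensional ℂ E']
    ⦃M' : Type⦄ [TopologicalSpace M'] [ChartedSpace E' M'] ⦃e : ℕ⦄ ⦃ψ : M' → ComplexPoints Y⦄,
    IsAnalytification E' Y e ψ →
      IsAnalyticSet 𝓘(ℂ, E') (ψ ⁻¹' Set.range (AlgPoints.map g : ComplexPoints X → ComplexPoints Y))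

/-- **The analytic structure of a closed smooth subvariety is the induced one** (Serre, GAGA §2 n°5,
p. 9: «de plus, la structure analytique de `Y^h` coïncide avec la structure analytique induite sur
`Y` par `X^h`»; the induced structure of an analytic subset is that of n°3: holomorphic functions
are the restrictions of holomorphic functions of the ambient space). Rendering, in the setting of
`IsAnalytification.mdifferentiable_comp_map`: `g : X ⟶ Y` a closed immersion of smooth `k`-schemes
(`k ⊆ ℂ`, relative dimensions `d`, `e`, locally of finite type), `φ : M → X(ℂ)` and
`ψ : M' → Y(ℂ)` analytifications carrying holomorphic atlases, and `h : M → M'` the induced map,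
`ψ ∘ h = g(ℂ) ∘ φ` (holomorphic by `mdifferentiable_comp_map_holds`). Then every `ℂᵐ`-valued
function `f` holomorphic on an open `U ⊆ M` is, near each `x ∈ U`, a pull-back along `h`: there are
an open `W ∋ h x` of `M'` and `F` holomorphic on `W` with `F (h y) = f y` for all `y ∈ U` with
`h y ∈ W`. (For smooth `Y ⊆ X` this is the local holomorphic retraction of `X^h` onto the complex
submanifold `Y^h`.) [cite: SerreGAGA1956, §2 n°5 p. 9 (structure analytique induite) with n°3] -/
def exists_mdifferentiableOn_extension_of_isClosedImmersion : Prop :=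
  ∀ ⦃k : Type⦄ [Field k] [Algebra k ℂ] ⦃X Y : SchemeOver k⦄ (g : X ⟶ Y) [IsClosedImmersion g.left]
    [LocallyOfFiniteType X.hom] [LocallyOfFiniteType Y.hom]
    ⦃E : Type⦄ [NormedAddCommGroup E] [NormedSpace ℂ E] [FiniteDimensional ℂ E]
    ⦃E' : Type⦄ [NormedAddCommGroup E'] [NormedSpace ℂ E'] [FiniteDimensional ℂ E']
    ⦃M : Type⦄ [TopologicalSpace M] [ChartedSpace E M]
    ⦃M' : Type⦄ [TopologicalSpace M'] [ChartedSpace E' M']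
    ⦃d e : ℕ⦄ ⦃φ : M → ComplexPoints X⦄ ⦃ψ : M' → ComplexPoints Y⦄,
    IsAnalytification E X d φ → IsAnalytification E' Y e ψ →
    ∀ [SmoothOfRelativeDimension d X.hom] [SmoothOfRelativeDimension e Y.hom]
      [IsManifold 𝓘(ℂ, E) ω M] [IsManifold 𝓘(ℂ, E') ω M'] ⦃h : M → M'⦄,
      ψ ∘ h = AlgPoints.map g ∘ φ →
      ∀ ⦃U : Set M⦄, IsOpen U → ∀ ⦃m : ℕ⦄ ⦃f : M → (Fin m → ℂ)⦄,
        MDifferentiableOn 𝓘(ℂ, E) 𝓘(ℂ, Fin m → ℂ) f U → ∀ ⦃x : M⦄, x ∈ U →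
          ∃ W : Set M', IsOpen W ∧ h x ∈ W ∧ ∃ F : M' → (Fin m → ℂ),
            MDifferentiableOn 𝓘(ℂ, E') 𝓘(ℂ, Fin m → ℂ) F W ∧ ∀ y ∈ U, h y ∈ W → F (h y) = f y

/-! ### Corollary (proved): closed embeddings of analytifications preserve analytic subsets -/

section Pushforward

variable {k : Type} [Field k] [Algebra k ℂ] {X Y : SchemeOver k}
  {E : Type} [NormedAddCommGroup E] [NormedSpace ℂ E] [FiniteDimensional ℂ E]
  {E' : Type} [NormedAddCommGroup E'] [NormedSpace ℂ E'] [FiniteDimensional ℂ E']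
  {M : Type} [TopologicalSpace M] [ChartedSpace E M]
  {M' : Type} [TopologicalSpace M'] [ChartedSpace E' M']
  {d e : ℕ} {φ : M → ComplexPoints X} {ψ : M' → ComplexPoints Y}

/-- The image of the induced map `h : M → M'` between analytifications (`ψ ∘ h = g(ℂ) ∘ φ`) is the
preimage under `ψ` of the image of `g(ℂ) : X(ℂ) → Y(ℂ)` (`φ`, `ψ` are bijections). [folklore] -/
theorem range_eq_preimage_range_map_of_comp_eq (hφ : IsAnalytification E X d φ)
    (hψ : IsAnalytification E' Y e ψ) (g : X ⟶ Y) {h : M → M'}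
    (hh : ψ ∘ h = AlgPoints.map g ∘ φ) :
    Set.range h = ψ ⁻¹' Set.range (AlgPoints.map g : ComplexPoints X → ComplexPoints Y) := by
  have hhm : ∀ m, ψ (h m) = AlgPoints.map g (φ m) := fun m ↦ congrFun hh m
  ext p
  simp only [Set.mem_range, Set.mem_preimage]
  constructor
  · rintro ⟨m, rfl⟩
    exact ⟨φ m, (hhm m).symm⟩
  · rintro ⟨P, hP⟩
    obtain ⟨m, rfl⟩ := hφ.isHomeomorph.surjective P
    exact ⟨m, hψ.isHomeomorph.injective ((hhm m).trans hP)⟩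

/-- **Closed embeddings of analytifications preserve analytic subsets** (corollary of GAGA §2 n°5,
p. 9). Assume the two §5 facts `isAnalyticSet_preimage_range_map_of_isClosedImmersion` (`h(M)` is
analytic in `M'`) and `exists_mdifferentiableOn_extension_of_isClosedImmersion` (holomorphic
functions on `M` extend locally along `h`). If `g : X ⟶ Y` is a closed immersion of smooth
`k`-schemes, `φ`, `ψ` are analytifications with holomorphic atlases, `ψ ∘ h = g(ℂ) ∘ φ` and `h` is a
closed topological embedding, then `h(S)` is an analytic subset of `M'` for every analytic subset
`S ⊆ M`: near `h x`, `x ∈ S`, take local equations `f = 0` of `S` on `U ∋ x`, extensions `F` of `f`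
on `W`, equations `G = 0` of `h(M)` on `W₁`, and an open `W₀` with `h⁻¹(W₀) = U`; then
`h(S) ∩ (W ∩ W₁ ∩ W₀) = {F = 0, G = 0}`. Away from the closed set `h(S)` there is nothing to check.
[cite: SerreGAGA1956, §2 n°5 p. 9] -/
theorem isAnalyticSet_image_of_isClosedImmersion
    (h₁ : isAnalyticSet_preimage_range_map_of_isClosedImmersion)
    (h₂ : exists_mdifferentiableOn_extension_of_isClosedImmersion)
    [LocallyOfFiniteType X.hom] [LocallyOfFiniteType Y.hom] [SmoothOfRelativeDimension d X.hom]
    [SmoothOfRelativeDimension e Y.hom] [IsManifold 𝓘(ℂ, E) ω M] [IsManifold 𝓘(ℂ, E') ω M']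
    (hφ : IsAnalytification E X d φ) (hψ : IsAnalytification E' Y e ψ) (g : X ⟶ Y)
    [IsClosedImmersion g.left] {h : M → M'} (hh : ψ ∘ h = AlgPoints.map g ∘ φ)
    (hemb : Topology.IsClosedEmbedding h) {S : Set M} (hS : IsAnalyticSet 𝓘(ℂ, E) S) :
    IsAnalyticSet 𝓘(ℂ, E') (h '' S) := by
  intro q
  by_cases hq : q ∈ h '' S
  · obtain ⟨x, hxS, rfl⟩ := hq
    -- local equations of `S` near `x`
    obtain ⟨U, hU, hxU, m, f, hf, hSU⟩ := hS x
    -- their holomorphic extensions along `h`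
    obtain ⟨W, hW, hxW, F, hF, hFf⟩ := h₂ g hφ hψ hh hU hf hxU
    -- local equations of `h(M)` near `h x`
    have hrange : IsAnalyticSet 𝓘(ℂ, E') (Set.range h) := by
      rw [range_eq_preimage_range_map_of_comp_eq hφ hψ g hh]
      exact h₁ g hψ
    obtain ⟨W₁, hW₁, hxW₁, m₁, G, hG, hRW₁⟩ := hrange (h x)
    -- `h` identifies `U` with the trace of an open set `W₀`
    obtain ⟨W₀, hW₀, hW₀U⟩ := hemb.isInducing.isOpen_iff.mp hU
    have hFi := (Literature.Geometry.Kaehler.mdifferentiableOn_pi_space (I := 𝓘(ℂ, E'))).1 hF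
    have hGi := (Literature.Geometry.Kaehler.mdifferentiableOn_pi_space (I := 𝓘(ℂ, E'))).1 hG
    refine IsAnalyticSetAt.of_fintype (ι := Fin m ⊕ Fin m₁) ((hW.inter hW₁).inter hW₀)
      ⟨⟨hxW, hxW₁⟩, by rw [← Set.mem_preimage, hW₀U]; exact hxU⟩
      (fun p ↦ Sum.elim (F p) (G p)) ?_ ?_
    · rintro (i | j)
      · exact (hFi i).mono (Set.inter_subset_left.trans Set.inter_subset_left)
      · exact (hGi j).mono (Set.inter_subset_left.trans Set.inter_subset_right)
    · ext p
      simp only [Set.mem_inter_iff, Set.mem_setOf_eq, Sum.forall, Sum.elim_inl, Sum.elim_inr]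
      constructor
      · rintro ⟨⟨y, hyS, rfl⟩, ⟨hyW, hyW₁⟩, hyW₀⟩
        have hyU : y ∈ U := by rw [← hW₀U]; exact hyW₀
        have hfy : f y = 0 := (hSU.subset ⟨hyS, hyU⟩).2
        have hGy : G (h y) = 0 := (hRW₁.subset ⟨Set.mem_range_self y, hyW₁⟩).2
        refine ⟨⟨⟨hyW, hyW₁⟩, hyW₀⟩, fun i ↦ ?_, fun j ↦ ?_⟩
        · rw [hFf y hyU hyW, hfy, Pi.zero_apply]
        · rw [hGy, Pi.zero_apply]
      · rintro ⟨⟨⟨hpW, hpW₁⟩, hpW₀⟩, hFp, hGp⟩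
        have hp : p ∈ Set.range h := (hRW₁.symm.subset ⟨hpW₁, funext hGp⟩).1
        obtain ⟨y, rfl⟩ := hp
        have hyU : y ∈ U := by rw [← hW₀U]; exact hpW₀
        have hfy : f y = 0 := by
          rw [← hFf y hyU hpW]
          exact funext hFp
        exact ⟨⟨y, (hSU.symm.subset ⟨hyU, hfy⟩).1, rfl⟩, ⟨hpW, hpW₁⟩, hpW₀⟩
  · have hcl : IsClosed (h '' S) := hemb.isClosedMap _ hS.isClosed
    exact IsAnalyticSetAt.of_notMem_closure (by rwa [hcl.closure_eq])

end Pushforward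

/-! ### The assembly: Chow in `ℙᴺ(ℂ)` and GAGA §5 imply `chow_analyticSet_analytification` -/

section Assembly

open Literature.NumberTheory.Transcendental (projPoint isAnalytification_projPoint
  isHomeomorph_projPoint preimage_projPoint_setOf_pt_mem_basicOpen)
open Projectivization (projZeroLocus)

-- `Proj.basicOpen` for `ℙᴺ_ℂ = Proj ℂ[x₀, …, x_N]` needs the grading instance, as in
-- `Motives/GAGA.lean` and `AnalytificationProjProofs.lean` (Mathlib ships it as a `def`).
attribute [local instance] MvPolynomial.gradedAlgebra

/-- **Assembly (proved).** Chow's theorem in every `ℙᴺ(ℂ)` (the tree's named fact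
`Motives.isProjAlgebraicSet_of_isAnalyticSet`, hodge.S17; Serre, GAGA §19 Prop. 13: «Tout
sous-ensemble analytique fermé de l'espace projectif est algébrique»; Chow 1949 Thm. V) together
with the two clauses of GAGA §2 n°5 p. 9 for the closed immersion `ι : X ↪ ℙᴺ`
(`isAnalyticSet_preimage_range_map_of_isClosedImmersion`,
`exists_mdifferentiableOn_extension_of_isClosedImmersion`) imply
`chow_analyticSet_analytification`: a closed analytic subset `S` of an analytification `M` of a
smooth projective `X/ℂ` is `φ⁻¹(Z(ℂ))` with `Z = ι⁻¹(V₊(F₁, …, Fᵣ))`, where `F₁, …, Fᵣ` are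
homogeneous equations of the closed analytic subset `h(S) ⊆ ℙᴺ(ℂ)`, `h = projPoint⁻¹ ∘ ι(ℂ) ∘ φ`
(a closed embedding: `M` is compact and `ℙᴺ(ℂ)` Hausdorff). See the module docstring.
[cite: SerreGAGA1956, §19 Prop. 13 and §2 n°5 p. 9] [cite: Chow1949, Thm. V] -/
theorem chow_analyticSet_analytification_of
    (hChow : ∀ N : ℕ, Motives.isProjAlgebraicSet_of_isAnalyticSet (n := N))
    (h₁ : isAnalyticSet_preimage_range_map_of_isClosedImmersion)
    (h₂ : exists_mdifferentiableOn_extension_of_isClosedImmersion) :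
    chow_analyticSet_analytification := by
  intro n X hX E _ _ _ M _ _ _ φ hφ S hS
  classical
  -- a projective embedding `ι : X ↪ ℙᴺ` and the instances it brings
  obtain ⟨N, ι, hι⟩ := hX.isProjectiveOver
  haveI := hι
  haveI : SmoothOfRelativeDimension n X.hom := hX.smoothOfRelativeDimension
  haveI : Smooth X.hom := SmoothOfRelativeDimension.smooth n X.hom
  haveI : LocallyOfFiniteType X.hom := inferInstance
  haveI : LocallyOfFiniteType (Motives.projectiveSpace N ℂ).hom := inferInstance
  haveI : SmoothOfRelativeDimension N (Motives.projectiveSpace N ℂ).hom :=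
    (Motives.isSmoothProjective_projectiveSpace_holds ℂ N).smoothOfRelativeDimension
  haveI : IsManifold 𝓘(ℂ, Fin N → ℂ) ω (ℙ ℂ (Fin (N + 1) → ℂ)) :=
    Literature.NumberTheory.Transcendental.isManifold_projectivization_holds ℂ N
  haveI : T2Space (ℙ ℂ (Fin (N + 1) → ℂ)) :=
    Literature.NumberTheory.Transcendental.t2Space_projectivization_holds ℂ N
  -- `M` is compact: `X` is proper, so `X(ℂ)` is compact
  haveI : IsProper X.hom := Motives.IsSmoothProjective.isProper_holds hX
  haveI : CompactSpace (ComplexPoints X) := Motives.compactSpace_algPoints_of_isProper_holds X ℂ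
  haveI : CompactSpace M := hφ.homeomorph.symm.compactSpace
  -- the induced map `h : M → ℙᴺ(ℂ)`, a closed embedding
  have hψ : IsAnalytification (Fin N → ℂ) (Motives.projectiveSpace N ℂ) N (projPoint N) :=
    isAnalytification_projPoint N
  obtain ⟨h, hhdef⟩ : ∃ h : M → ℙ ℂ (Fin (N + 1) → ℂ),
      h = fun m ↦ hψ.homeomorph.symm (AlgPoints.map ι (φ m)) := ⟨_, rfl⟩
  have hhm : ∀ m, projPoint N (h m) = AlgPoints.map ι (φ m) := fun m ↦ by
    rw [hhdef]
    exact hψ.homeomorph.apply_symm_apply _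
  have hh : projPoint N ∘ h = AlgPoints.map ι ∘ φ := funext hhm
  have hcont : Continuous h := hhdef ▸ hψ.homeomorph.symm.continuous.comp
    ((AlgPoints.continuous_map ι).comp hφ.isHomeomorph.continuous)
  have hinj : Function.Injective h := hhdef ▸
    hψ.homeomorph.symm.injective.comp ((AlgPoints.map_injective ι).comp hφ.isHomeomorph.injective)
  have hemb : Topology.IsClosedEmbedding h := hcont.isClosedEmbedding hinj
  -- `h(S)` is a closed analytic subset of `ℙᴺ(ℂ)`, hence projective algebraic (Chow)
  have hT : IsAnalyticSet 𝓘(ℂ, Fin N → ℂ) (h '' S) :=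
    isAnalyticSet_image_of_isClosedImmersion h₁ h₂ hφ hψ ι hh hemb hS
  obtain ⟨Sₚ, hSₚ, hTeq⟩ := hChow N hT.isClosed hT
  -- membership in `h(S) = V(Sₚ)` in terms of the standard opens `D₊(F)`, `F ∈ Sₚ`
  obtain ⟨D, hD⟩ : ∃ D : MvPolynomial (Fin (N + 1)) ℂ → (Motives.projectiveSpace N ℂ).left.Opens,
      D = fun F ↦ Proj.basicOpen (MvPolynomial.homogeneousSubmodule (Fin (N + 1)) ℂ) F :=
    ⟨_, rfl⟩
  have hmemT : ∀ p : ℙ ℂ (Fin (N + 1) → ℂ), p ∈ h '' S ↔ ∀ F ∈ Sₚ, (projPoint N p).pt ∉ D F := by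
    intro p
    rw [hTeq]
    have hmem : p ∈ projZeroLocus (↑Sₚ : Set (MvPolynomial (Fin (N + 1)) ℂ)) ↔
        ∀ F ∈ Sₚ, MvPolynomial.eval p.rep F = 0 := by
      simp only [projZeroLocus, Set.mem_setOf_eq, Finset.mem_coe]
    rw [hmem]
    refine forall₂_congr fun F hF ↦ ?_
    have key := preimage_projPoint_setOf_pt_mem_basicOpen N F F.totalDegree (hSₚ F hF)
    have hp : p ∈ (projZeroLocus ({F} : Set (MvPolynomial (Fin (N + 1)) ℂ)))ᶜ ↔
        (projPoint N p).pt ∈ D F := by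
      rw [← key, hD]
      rfl
    have hsingle : p ∈ projZeroLocus ({F} : Set (MvPolynomial (Fin (N + 1)) ℂ)) ↔
        MvPolynomial.eval p.rep F = 0 := by
      simp only [projZeroLocus, Set.mem_setOf_eq, Set.mem_singleton_iff, forall_eq]
    rw [Set.mem_compl_iff, hsingle] at hp
    tauto
  -- the Zariski-closed set `Z = ι⁻¹(⋂_{F ∈ Sₚ} V₊(F))` and `S = φ⁻¹(Z(ℂ))`
  refine ⟨ι.left ⁻¹' {y | ∀ F ∈ Sₚ, y ∉ D F}, ?_, ?_⟩
  · refine IsClosed.preimage ι.left.continuous ?_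
    have hZ' : {y : (Motives.projectiveSpace N ℂ).left | ∀ F ∈ Sₚ, y ∉ D F} =
        ⋂ F ∈ Sₚ, {y : (Motives.projectiveSpace N ℂ).left | y ∉ D F} := by
      ext y
      simp only [Set.mem_setOf_eq, Set.mem_iInter]
    rw [hZ']
    exact isClosed_biInter fun F _ ↦ (D F).isOpen.isClosed_compl
  · ext x
    rw [Set.mem_preimage, Set.mem_setOf_eq, Set.mem_preimage, Set.mem_setOf_eq,
      ← hinj.mem_set_image, hmemT, hhm]
    rfl

end Assembly

end HodgeTheory

end Literature.AlgebraicGeometry.HodgeTheory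

end
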